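import Literature.Probability.LatticeModels.VillainDisorderedModel
import HarnessLib

/-!
# The angle-cube Villain two-point function is the pure Villain expectation on the torus `U(1)^V`

One PROVED identification between the tree's two Villain vocabularies (no definition, no named
fact): for a finite bond system `G` and a constant stiffness `K > 0`,

* `BondSystem.villainTwoPoint_eq_villainExpect` —
  `villainTwoPoint G.src G.tgt (fun _ => K) x y = ⟨cos(θ(x) − θ(y))⟩_{1,K}`,

where the left-hand side is the angle-cube two-point function of `VillainMonotonicity.lean`
(Lebesgue integrals over `[-π,π)^V`, used by the worm representation
`VillainCurrentModel.twoPoint_eq_ofReal_villainTwoPoint` of `VillainCurrentDuality.lean`) and the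
right-hand side is the pure (`u ≡ 1`) Villain Gibbs expectation of `VillainDisorderedModel`
(Haar integrals over `U(1)^V`, the form in which the Garban–Spencer long-range order for the
Villain interaction, `villain_longRangeOrder`, is proved).  Haar integrals over `U(1)^V` are
`(2π)^{-|V|}` times Lebesgue integrals over the angle cube
(`CircleHaar.integral_pi_haarProbability_circle`), and the normalisations cancel in the ratio.

## References

* [AizenmanHarelPeledShapiro2021] M. Aizenman, M. Harel, R. Peled, J. Shapiro, arXiv:2110.09498,
  §3.1 (the Villain model on a finite graph, angle form).
* [GarbanSpencer2022] C. Garban, T. Spencer, J. Math. Phys. 63 (2022) 093302, (1.1), (1.4)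
  (Gibbs expectations w.r.t. the normalised Haar measure of `U(1)^Λ`).
-/

noncomputable section

namespace Literature.Probability.LatticeModels

open MeasureTheory Finset TopologicalSpace Filter Set
open scoped BigOperators ComplexConjugate Topology
open Literature.MathematicalPhysics.QuantumFieldTheory

/-! ### The angle-cube two-point function is the pure Villain expectation on the torus `U(1)^V` -/

namespace BondSystem

/-- **Bridge between the two Villain vocabularies.** For a finite bond system `G` and `K > 0`,
the angle-cube two-point function of `VillainMonotonicity.lean` on the multigraph of `G` with
constant stiffness `K` is the pure (`u ≡ 1`) Villain expectation of `cos(θ(x) − θ(y))` on the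
torus `U(1)^V`: `villainTwoPoint G.src G.tgt (fun _ => K) x y = ⟨cos(θ(x) − θ(y))⟩_{1,K}`
(Haar integrals over `U(1)^V` are `(2π)^{-|V|}` times Lebesgue integrals over `[-π,π)^V`,
`CircleHaar.integral_pi_haarProbability_circle`; the normalisations cancel). [folklore] -/
theorem villainTwoPoint_eq_villainExpect {V ι : Type*} [Fintype V] [Fintype ι] (G : BondSystem V ι)
    {K : ℝ} (hK : 0 < K) (x y : V) :
    villainTwoPoint G.src G.tgt (fun _ => K) x y = G.villainExpect K 1 (cosDiff x y) := by
  set E : (V → ℝ) → (V → Circle) := fun θ v => Circle.exp (θ v) with hEdef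
  have harg : ∀ r : ℝ, villainKernel K (Complex.arg (Circle.exp r : ℂ)) = villainKernel K r := fun r => by
    rw [Circle.coe_exp, Complex.arg_exp_mul_I, toIocMod]
    exact (show Function.Periodic (villainKernel K) (2 * Real.pi) from
      villainKernel_add_two_pi K).sub_zsmul_eq _
  -- pull-backs along `θ ↦ (e^{iθ_v})_v`
  have hWE : ∀ θ : V → ℝ, G.villainWeight K 1 (E θ) = villainSpinWeight G.src G.tgt (fun _ => K) θ := by
    intro θ
    simp only [villainWeight, villainSpinWeight, bondVar_one, hEdef]
    refine Finset.prod_congr rfl fun a _ => ?_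
    rw [← Circle.exp_neg, ← Circle.exp_add, neg_add_eq_sub, harg]
  have hfE : ∀ θ : V → ℝ, cosDiff x y (E θ) = Real.cos (θ x - θ y) := fun θ => by
    simp only [cosDiff, hEdef]
    rw [← Circle.coe_inv_eq_conj, ← Circle.coe_mul, ← Circle.exp_neg, ← Circle.exp_add, Circle.coe_exp,
      Complex.exp_ofReal_mul_I_re, neg_add_eq_sub, ← Real.cos_neg, neg_sub]
  -- Haar integrals over `U(1)^V` are angle integrals over the cube `[-π, π)^V`
  have htr : ∀ F : (V → Circle) → ℝ, Continuous F →
      ∫ u, F u ∂torusHaar V = ((2 * Real.pi)⁻¹) ^ Fintype.card V * ∫ θ in angleCube V, F (E θ) :=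
    fun F hF => by
    rw [show torusHaar V = Measure.pi (fun _ : V => haarProbability Circle) from rfl,
      CircleHaar.integral_pi_haarProbability_circle F hF.aestronglyMeasurable,
      CircleHaar.setIntegral_pi_Ioc_eq_pi_Ico, smul_eq_mul]
    rfl
  have hc : (0 : ℝ) < ((2 * Real.pi)⁻¹) ^ Fintype.card V := by positivity
  have hw := G.continuous_villainWeight hK 1
  have hf : Continuous (cosDiff x y : (V → Circle) → ℝ) := continuous_cosDiff x y
  unfold villainExpect villainPartitionFn villainTwoPoint
  rw [htr (fun u => cosDiff x y u * G.villainWeight K 1 u) (hf.mul hw), htr _ hw,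
    mul_div_mul_left _ _ hc.ne']
  simp only [hWE, hfE]

end BondSystem

end Literature.Probability.LatticeModels
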